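import Mathlib.Analysis.InnerProductSpace.Calculus
import Literature.Analysis.Calculus.PlanarRotation
import Literature.Analysis.Calculus.AngularMomentumFields
import HarnessLib

/-!
# The divergence theorem on spheres (extrinsic form)

Analysis support file (everything proved; no definitions, no named facts) for the cylindrical
coordinates of A. Waldron, *Long-time existence for Yang–Mills flow*, Invent. math. 217 (2019),
§4: every integration by parts on the spheres `S_r ⊂ ℝⁿ` (the energy identities for the
components `f₁, g₁, g₂`, the Bochner identities behind Lemma 3.5) rests on the **divergence
theorem on `S_r`**, which we obtain extrinsically from the rotation invariance of the sphere
measure (`sphereIntegral_fderiv_angular_eq_zero`) and the algebra of the angular-momentum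
fields `L_{ij}` (`∑ᵢ∑ⱼ L_{ij} ⊗ L_{ij} = 2(‖x‖²𝟙 − x ⊗ x)`, `∑ᵢ∑ⱼ L_{ij}(L_{ij}x) = −2(n−1)x`):

* `integrable_toSphere_of_continuousOn`, `sphereIntegral_add`, `sphereIntegral_finset_sum` —
  integrability on the (finite) sphere measure and linearity of `sphereIntegral` for integrands
  continuous away from the origin;
* `sum_sum_sphereIntegral_fderiv_inner_angularField_eq_zero` —
  `∑ᵢ∑ⱼ ∫_S ∂_{L_{ij}}⟨X, L_{ij}⟩ = 0`, expanded by the product rule;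
* `sphereIntegral_div_sub_eq_zero` — **the divergence theorem on the sphere `S_r`**:
  `∫_S (‖x‖² tr DX(x) − ⟨DX(x)x, x⟩ − (n − 1)⟨X(x), x⟩) dσ = 0` at radius `r > 0`
  (`x = rθ`), i.e. `∫_{S_r} (div X − ⟨∇_νX, ν⟩ − ((n−1)/r)⟨X, ν⟩) = 0`; for a tangential field
  (`⟨X, x⟩ = 0`) this is `∫_{S_r} div_{S_r} X = 0`.

References: A. Waldron, Invent. math. 217 (2019), §4.2 [Waldron2019]; (divergence theorem on
spheres) [folklore].
-/

noncomputable section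

open MeasureTheory Set Metric Filter
open scoped Topology RealInnerProductSpace

namespace Literature.Analysis.Calculus

variable {E : Type*} [NormedAddCommGroup E] [InnerProductSpace ℝ E] [FiniteDimensional ℝ E]
  [MeasurableSpace E] [BorelSpace E]

/-- A function continuous away from the origin is integrable on the unit sphere dilated by
`r > 0`, for the finite sphere measure `volume.toSphere`. [folklore] -/
theorem integrable_toSphere_of_continuousOn {g : E → ℝ} (hg : ContinuousOn g {0}ᶜ) {r : ℝ}
    (hr : 0 < r) :
    Integrable (fun θ : sphere (0 : E) 1 => g (r • (θ : E))) (volume : Measure E).toSphere := by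
  have hcont : Continuous fun θ : sphere (0 : E) 1 => g (r • (θ : E)) := by
    refine hg.comp_continuous (continuous_const.smul continuous_subtype_val) fun θ => ?_
    simp only [mem_compl_iff, mem_singleton_iff, smul_eq_zero, not_or]
    exact ⟨hr.ne', ne_zero_of_mem_unit_sphere θ⟩
  exact hcont.integrable_of_hasCompactSupport (HasCompactSupport.of_compactSpace _)

/-- Additivity of `sphereIntegral` for integrands continuous away from the origin (`r > 0`).
[folklore] -/
theorem sphereIntegral_add {g h : E → ℝ} (hg : ContinuousOn g {0}ᶜ) (hh : ContinuousOn h {0}ᶜ)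
    {r : ℝ} (hr : 0 < r) :
    Literature.Analysis.FluidPDE.sphereIntegral (volume : Measure E) (fun x => g x + h x) r =
      Literature.Analysis.FluidPDE.sphereIntegral (volume : Measure E) g r +
        Literature.Analysis.FluidPDE.sphereIntegral (volume : Measure E) h r := by
  simp only [Literature.Analysis.FluidPDE.sphereIntegral]
  exact integral_add (integrable_toSphere_of_continuousOn hg hr)
    (integrable_toSphere_of_continuousOn hh hr)

/-- `sphereIntegral` of a finite sum of integrands continuous away from the origin (`r > 0`).
[folklore] -/
theorem sphereIntegral_finset_sum {κ : Type*} (s : Finset κ) {g : κ → E → ℝ}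
    (hg : ∀ k ∈ s, ContinuousOn (g k) {0}ᶜ) {r : ℝ} (hr : 0 < r) :
    Literature.Analysis.FluidPDE.sphereIntegral (volume : Measure E) (fun x => ∑ k ∈ s, g k x) r =
      ∑ k ∈ s, Literature.Analysis.FluidPDE.sphereIntegral (volume : Measure E) (g k) r := by
  simp only [Literature.Analysis.FluidPDE.sphereIntegral]
  exact integral_finsetSum s fun k hk => integrable_toSphere_of_continuousOn (hg k hk) hr

variable {ι : Type*} [Fintype ι]

omit [FiniteDimensional ℝ E] [MeasurableSpace E] [BorelSpace E] in
/-- The angular fields are continuous (they are continuous linear maps). [folklore] -/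
theorem continuous_angularField (b : OrthonormalBasis ι ℝ E) (i j : ι) :
    Continuous (angularField b i j) := by
  have h : angularField b i j =
      fun y => ((innerSL ℝ (b i)).smulRight (b j) - (innerSL ℝ (b j)).smulRight (b i)) y :=
    funext fun y => angularField_eq_clm b i j y
  rw [h]
  exact ContinuousLinearMap.continuous _

/-- **`∑ᵢ∑ⱼ ∫_S ∂_{L_{ij}}⟨X, L_{ij}⟩ dσ = 0`, expanded**: for a `C¹` vector field `X` away from
the origin and `r > 0`,
`∫_S (∑ᵢ∑ⱼ ⟨DX(x)(L_{ij}x), L_{ij}x⟩ + ⟨X(x), ∑ᵢ∑ⱼ L_{ij}(L_{ij}x)⟩) dσ = 0` (`x = rθ`).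
[folklore] -/
theorem sphereIntegral_sum_sum_inner_fderiv_angularField_eq_zero [Nontrivial E]
    (b : OrthonormalBasis ι ℝ E) {X : E → E} (hX : ContDiffOn ℝ 1 X {0}ᶜ) {r : ℝ} (hr : 0 < r) :
    Literature.Analysis.FluidPDE.sphereIntegral (volume : Measure E)
      (fun x => ∑ i, ∑ j, ⟪fderiv ℝ X x (angularField b i j x), angularField b i j x⟫ +
        ⟪X x, ∑ i, ∑ j, angularField b i j (angularField b i j x)⟫) r = 0 := by
  have hO : IsOpen ({0}ᶜ : Set E) := isOpen_compl_singleton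
  have hXd : ∀ x ∈ ({0}ᶜ : Set E), HasFDerivAt X (fderiv ℝ X x) x := fun x hx =>
    ((hX.differentiableOn one_ne_zero).differentiableAt (hO.mem_nhds hx)).hasFDerivAt
  have hXc : ContinuousOn X {0}ᶜ := hX.continuousOn
  have hDXc : ContinuousOn (fun x => fderiv ℝ X x) {0}ᶜ := hX.continuousOn_fderiv_of_isOpen hO le_rfl
  have hLc := continuous_angularField b
  -- the functions `q_{ij} = ⟨X, L_{ij}⟩` and their angular derivatives
  have hq : ∀ i j, ContDiffOn ℝ 1 (fun x => ⟪X x, angularField b i j x⟫) {0}ᶜ := fun i j => by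
    have hL1 : ContDiff ℝ 1 (angularField b i j) := by
      have h : angularField b i j =
          fun y => ((innerSL ℝ (b i)).smulRight (b j) - (innerSL ℝ (b j)).smulRight (b i)) y :=
        funext fun y => angularField_eq_clm b i j y
      rw [h]; exact ContinuousLinearMap.contDiff _
    exact ContDiffOn.inner (𝕜 := ℝ) hX hL1.contDiffOn
  have hdq : ∀ i j, ∀ x ∈ ({0}ᶜ : Set E),
      fderiv ℝ (fun y => ⟪X y, angularField b i j y⟫) x (angularField b i j x) =
        ⟪fderiv ℝ X x (angularField b i j x), angularField b i j x⟫ +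
          ⟪X x, angularField b i j (angularField b i j x)⟫ := by
    intro i j x hx
    have h1 := hXd x hx
    have h2 := hasFDerivAt_angularField b i j x
    rw [(HasFDerivAt.inner (𝕜 := ℝ) h1 h2).fderiv]
    simp only [ContinuousLinearMap.comp_apply, ContinuousLinearMap.prod_apply, fderivInnerCLM_apply]
    rw [← angularField_eq_clm b i j (angularField b i j x), add_comm]
  -- each angular derivative integrates to zero over the sphere
  have hzero : ∀ i j, Literature.Analysis.FluidPDE.sphereIntegral (volume : Measure E)
      (fun x => fderiv ℝ (fun y => ⟪X y, angularField b i j y⟫) x (angularField b i j x)) r = 0 := by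
    intro i j
    by_cases hij : i = j
    · subst hij
      have h0 : ∀ x, angularField b i i x = 0 := fun x => by simp [angularField]
      simp only [h0, map_zero, Literature.Analysis.FluidPDE.sphereIntegral, integral_zero]
    · have hu : ‖b i‖ = 1 := b.orthonormal.1 i
      have hv : ‖b j‖ = 1 := b.orthonormal.1 j
      have huv : ⟪b i, b j⟫ = 0 := b.orthonormal.2 hij
      have h := sphereIntegral_fderiv_angular_eq_zero hu hv huv (hq i j) hr
      simpa only [angularField] using h
  -- continuity of the expanded integrands away from the origin
  have hc1 : ∀ i j, ContinuousOn
      (fun x => ⟪fderiv ℝ X x (angularField b i j x), angularField b i j x⟫) {0}ᶜ := fun i j =>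
    (hDXc.clm_apply (hLc i j).continuousOn).inner (hLc i j).continuousOn
  have hc2 : ∀ i j, ContinuousOn
      (fun x => ⟪X x, angularField b i j (angularField b i j x)⟫) {0}ᶜ := fun i j =>
    hXc.inner ((hLc i j).comp (hLc i j)).continuousOn
  have hc12 : ∀ i j, ContinuousOn (fun x => ⟪fderiv ℝ X x (angularField b i j x), angularField b i j x⟫ +
      ⟪X x, angularField b i j (angularField b i j x)⟫) {0}ᶜ := fun i j => (hc1 i j).add (hc2 i j)
  -- sum over `i, j`
  have hsum : Literature.Analysis.FluidPDE.sphereIntegral (volume : Measure E)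
      (fun x => ∑ i, ∑ j, (⟪fderiv ℝ X x (angularField b i j x), angularField b i j x⟫ +
        ⟪X x, angularField b i j (angularField b i j x)⟫)) r = 0 := by
    rw [sphereIntegral_finset_sum Finset.univ (fun i _ => continuousOn_finsetSum _ fun j _ => hc12 i j) hr]
    refine Finset.sum_eq_zero fun i _ => ?_
    rw [sphereIntegral_finset_sum Finset.univ (fun j _ => hc12 i j) hr]
    refine Finset.sum_eq_zero fun j _ => ?_
    rw [← hzero i j]
    simp only [Literature.Analysis.FluidPDE.sphereIntegral]
    refine integral_congr_ae (ae_of_all _ fun θ => ?_)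
    have hθ : (r • (θ : E)) ∈ ({0}ᶜ : Set E) := by
      simp only [mem_compl_iff, mem_singleton_iff, smul_eq_zero, not_or]
      exact ⟨hr.ne', ne_zero_of_mem_unit_sphere θ⟩
    exact (hdq i j _ hθ).symm
  -- rearrange the integrand
  have heq : (fun x => ∑ i, ∑ j, ⟪fderiv ℝ X x (angularField b i j x), angularField b i j x⟫ +
      ⟪X x, ∑ i, ∑ j, angularField b i j (angularField b i j x)⟫) =
      fun x => ∑ i, ∑ j, (⟪fderiv ℝ X x (angularField b i j x), angularField b i j x⟫ +
        ⟪X x, angularField b i j (angularField b i j x)⟫) := by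
    funext x
    simp only [inner_sum, Finset.sum_add_distrib]
  rw [heq]
  exact hsum

/-- **The divergence theorem on the sphere `S_r` (extrinsic form).** For a `C¹` vector field
`X` away from the origin, an orthonormal frame `b` (`n = card ι = dim E`) and `r > 0`:
`∫_S (‖x‖² ∑ₖ ⟨DX(x)bₖ, bₖ⟩ − ⟨DX(x)x, x⟩ − (n − 1)⟨X(x), x⟩) dσ(θ) = 0`, `x = rθ`, i.e.
`∫_{S_r} (div X − ⟨∇_νX, ν⟩ − ((n−1)/r)⟨X, ν⟩) = 0`; for a field tangent to the spheres the
integrand is the intrinsic divergence `div_{S_r} X`. [folklore] -/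
theorem sphereIntegral_div_sub_eq_zero [Nontrivial E] [DecidableEq ι] (b : OrthonormalBasis ι ℝ E)
    {X : E → E} (hX : ContDiffOn ℝ 1 X {0}ᶜ) {r : ℝ} (hr : 0 < r) :
    Literature.Analysis.FluidPDE.sphereIntegral (volume : Measure E)
      (fun x => ‖x‖ ^ 2 * ∑ k, ⟪fderiv ℝ X x (b k), b k⟫ - ⟪fderiv ℝ X x x, x⟫ -
        ((Fintype.card ι : ℝ) - 1) * ⟪X x, x⟫) r = 0 := by
  have h := sphereIntegral_sum_sum_inner_fderiv_angularField_eq_zero b hX hr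
  -- pointwise algebra: contract the bilinear form `(u, v) ↦ ⟨DX(x)u, v⟩` with the angular fields
  have hpt : ∀ x : E, ∑ i, ∑ j, ⟪fderiv ℝ X x (angularField b i j x), angularField b i j x⟫ +
      ⟪X x, ∑ i, ∑ j, angularField b i j (angularField b i j x)⟫ =
      2 * (‖x‖ ^ 2 * ∑ k, ⟪fderiv ℝ X x (b k), b k⟫ - ⟪fderiv ℝ X x x, x⟫ -
        ((Fintype.card ι : ℝ) - 1) * ⟪X x, x⟫) := by
    intro x
    have h1 := sum_sum_bilinear_angularField b ((innerSL ℝ (E := E)).comp (fderiv ℝ X x)) x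
    simp only [ContinuousLinearMap.comp_apply, innerSL_apply_apply] at h1
    rw [h1, sum_sum_angularField_angularField b x, inner_smul_right]
    ring
  have heq : (fun x : E => ‖x‖ ^ 2 * ∑ k, ⟪fderiv ℝ X x (b k), b k⟫ - ⟪fderiv ℝ X x x, x⟫ -
      ((Fintype.card ι : ℝ) - 1) * ⟪X x, x⟫) = fun x => (1 / 2 : ℝ) *
      (∑ i, ∑ j, ⟪fderiv ℝ X x (angularField b i j x), angularField b i j x⟫ +
        ⟪X x, ∑ i, ∑ j, angularField b i j (angularField b i j x)⟫) := by
    funext x; rw [hpt x]; ring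
  rw [heq]
  simp only [Literature.Analysis.FluidPDE.sphereIntegral, integral_const_mul] at h ⊢
  rw [h, mul_zero]

end Literature.Analysis.Calculus
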